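import Summits.ValiantsHypothesis.ValiantsHypothesis.Theorems.BarrierLeverChowBenchmarkPairsSplitCert

/-!
# Route BarrierLever — item 22038 `ChowBenchmarkPairs`, line `moore-peel`: SPLIT CERTIFICATES — part 4: the HOMOGENEOUS root
# (the origin as a generic `(h+1)`-st point; rows `R_0²`, `R_0R_a`, `R_aR_b`) and homogeneous segment mean-value unisolvence
# `HSMVAt h` from a certificate

Helper file (`--supports stmt-ValiantsHypothesis-22038`; cell valiant-natproofs, rung V4; seat val-np-p4 gen 24).  Closes NO item.

The split numerics of val-np-p4 g23 (memo HOME/val-np-p4/g23/ §4: «Root: one block `W(r_h)`, rows `R_0², R_0R_a, R_aR_b` (homogeneous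
form; `P_0` generic)») and this seat's generator work in the HOMOGENEOUS picture: the origin is an explicit point `0` with GENERIC
coordinates, the line's rows become the weighted rows `({0}, w_0 = 2)`, `({0,a}, (1,1))`, `({a,b}, (1,1))` (`1 ≤ a < b ≤ h`) — all of total
weight `2` — on the first `r_h = windowStart (h+1)` binary codes.  In this form TOP-ONLY TRIANGULAR certificates exist at every height
tried (g23: every `h ≤ 31`, kit j314566/j314779/j315456; this seat's `num/homog.py` re-finds them for `h ≤ 12` in seconds), whereas with the
origin pinned at `0` (row `∅` inert) the same search already fails at `h = 7` — the origin must be allowed to be DOMINANT.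

* `rootInstW` — the root instance with per-row weights (`rootInstW_matrix`); `hRows h` — the homogeneous rows; `HSMVAt h` — «some table of
  `h+1` points makes the homogeneous `r_h × r_h` matrix nonsingular»; `hsmv_of_check` — a certificate gives `HSMVAt h` (soundness, part 3).

`HSMVAt h` and the line's `SegmentMeanValueAt h` have THE SAME truth value — the functionals {`δ_{P_0}`, Dirichlet means over `[P_0,P_a]`,
`[P_a,P_b]`} on the down-set space `span{z^T : code T < r_h}` are translation invariant (`P ↦ P − P_0` multiplies the matrix by a
unitriangular matrix in code order), and at `P_0 = 0` the homogeneous matrix IS the segment-moment matrix — but that transfer is NOT in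
this file (the translation lemma and the typed ∀h node with its arrow to `stub_segmentMeanValue` are the next files of the seat);
per-height instances by `decide +kernel` are in `…SplitCertInstances*`.

WHAT THIS IS NOT: no stub of the line is closed; nothing on crux stmt-ValiantsHypothesis-14610 or on `VP` versus `VNP`.
-/

set_option linter.dupNamespace false
set_option autoImplicit false

namespace Summit.ValiantsHypothesis.ValiantsHypothesis.Theorems.BarrierLever.ChowBenchmarkSplit

open Finset Polynomial
open Literature.Computability.Complexity (getD_ofFn)
open Summit.ValiantsHypothesis.ValiantsHypothesis.Theorems.BarrierLever.MoorePeel (windowStart windowStart_succ_le_two_pow)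

namespace Cert

variable {p k n : ℕ}

/-! ## 1. The weighted root instance -/

/-- **Root instance with per-row weights** `wts i = (w₁, w₂)` (default `(1,1)` beyond the list) on the first `n` binary codes; scalar `1`,
except `0` for an empty row at a nonzero code. -/
def rootInstW (rows : List (List ℕ)) (wts : List (ℕ × ℕ)) (n : ℕ) : Inst where
  sup := rows
  ent := List.ofFn fun i : Fin n => List.ofFn fun j : Fin n =>
    (if (rows.getD i []).isEmpty && !decide ((j : ℕ) = 0) then 0 else 1, (wts.getD i (1, 1)).1, (wts.getD i (1, 1)).2)
  col := List.range n

/-- The supports of the weighted root instance. -/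
theorem rootInstW_supL (rows : List (List ℕ)) (wts : List (ℕ × ℕ)) (i : ℕ) : (rootInstW rows wts n).supL i = rows.getD i [] := rfl

/-- The columns of the weighted root instance are the codes `j`. -/
theorem rootInstW_colN (rows : List (List ℕ)) (wts : List (ℕ × ℕ)) (j : Fin n) : (rootInstW rows wts n).colN j = j := by
  unfold Inst.colN rootInstW
  rw [List.getD_eq_getElem _ _ (by simp), List.getElem_range]

/-- The entries of the weighted root instance. -/
theorem rootInstW_entL (rows : List (List ℕ)) (wts : List (ℕ × ℕ)) (i j : Fin n) : (rootInstW rows wts n).entL i j =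
    (if (rows.getD i []).isEmpty && !decide ((j : ℕ) = 0) then 0 else 1, (wts.getD i (1, 1)).1, (wts.getD i (1, 1)).2) := by
  unfold Inst.entL rootInstW
  rw [getD_ofFn _ _ i.2, getD_ofFn _ _ j.2]

/-- **The matrix of the weighted root instance.** -/
theorem rootInstW_matrix {R : Type*} [CommRing R] (rows : List (List ℕ)) (wts : List (ℕ × ℕ)) (hn : n ≤ 2 ^ k)
    (P : Fin p → Fin k → R) :
    (rootInstW rows wts n).matrix p k n P =
      Matrix.of fun i j : Fin n => dirE P (Sof p (rows.getD i []))
        (fun a => wOf (rows.getD i []) (1, (wts.getD i (1, 1)).1, (wts.getD i (1, 1)).2) a) (Tof k j) := by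
  refine Matrix.ext fun i j => ?_
  rw [Inst.matrix, Matrix.of_apply, Matrix.of_apply, rootInstW_entL, rootInstW_colN, rootInstW_supL]
  by_cases h : ((rows.getD i []).isEmpty && !decide ((j : ℕ) = 0)) = true
  · rw [if_pos h, Nat.cast_zero, zero_mul]
    simp only [Bool.and_eq_true, List.isEmpty_iff, Bool.not_eq_true', decide_eq_false_iff_not] at h
    rw [h.1, Sof_nil, dirE_empty_row]
    exact Tof_nonempty h.2 (lt_of_lt_of_le j.2 hn)
  · rw [if_neg h, Nat.cast_one, one_mul]

/-! ## 2. The homogeneous rows of height `h` -/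

/-- **The homogeneous rows**: `[0]` (the origin, weight `2`: `R_0²`), `[0, a]` (`R_0R_a`), `[a, b]` (`R_aR_b`), `1 ≤ a < b ≤ h` — points
`0..h`, in this order (`r_h = windowStart (h+1)` rows). -/
def hRows (h : ℕ) : List (List ℕ) :=
  [[0]] ++ (List.range h).map (fun a => [0, a + 1]) ++
    (List.range h).flatMap fun b => (List.range b).map fun a => [a + 1, b + 1]

/-- The homogeneous weights: `(2, ·)` on the first row, `(1, 1)` elsewhere (default). -/
def hWts : List (ℕ × ℕ) := [(2, 1)]

/-- Every homogeneous row is a list of ≤ 2 distinct points `< h + 1`. -/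
theorem hRows_mem_spec {h : ℕ} {r : List ℕ} (hr : r ∈ hRows h) : r.length ≤ 2 ∧ (∀ x ∈ r, x < h + 1) ∧ r.Nodup := by
  unfold hRows at hr
  simp only [List.mem_append, List.mem_singleton, List.mem_map, List.mem_range, List.mem_flatMap] at hr
  rcases hr with (rfl | ⟨a, ha, rfl⟩) | ⟨b, hb, a, ha, rfl⟩
  · simp
  · refine ⟨by simp, ?_, by simp⟩
    intro x hx; simp only [List.mem_cons, List.not_mem_nil, or_false] at hx; omega
  · refine ⟨by simp, ?_, ?_⟩
    · intro x hx; simp only [List.mem_cons, List.not_mem_nil, or_false] at hx; omega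
    · simp; omega

/-- The well-formedness of the homogeneous rows, in the form `supOK` wants. -/
theorem hRows_spec (h : ℕ) : ∀ i < n, ((hRows h).getD i []).length ≤ 2 ∧ (∀ x ∈ (hRows h).getD i [], x < h + 1) ∧
    ((hRows h).getD i []).Nodup := by
  intro i _
  by_cases hi : i < (hRows h).length
  · rw [List.getD_eq_getElem _ _ hi]
    exact hRows_mem_spec (List.getElem_mem hi)
  · rw [List.getD_eq_default _ _ (not_lt.mp hi)]; simp

/-- The weight function of homogeneous row `i`. -/
def hwOf (h : ℕ) (i : ℕ) : Fin (h + 1) → ℕ :=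
  fun a => wOf ((hRows h).getD i []) (1, (hWts.getD i (1, 1)).1, (hWts.getD i (1, 1)).2) a

/-- **Homogeneous segment mean-value unisolvence at height `h`**: some table of `h + 1` points (point `0` = the free origin) makes
the `r_h × r_h` matrix «homogeneous rows × first `r_h` binary codes» of Dirichlet-weighted entries nonsingular. -/
def HSMVAt (h : ℕ) : Prop :=
  ∃ P : Fin (h + 1) → Fin h → ℂ,
    (Matrix.of fun i j : Fin (windowStart (h + 1)) =>
      dirE P (Sof (h + 1) ((hRows h).getD i [])) (hwOf h i) (Tof h j)).det ≠ 0

/-- **A certificate for the homogeneous root gives `HSMVAt h`.** -/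
theorem hsmv_of_check (h : ℕ) (ls : List Level)
    (hc : check h (windowStart (h + 1)) ls (rootInstW (hRows h) hWts (windowStart (h + 1))) = true) : HSMVAt h := by
  obtain ⟨P, hP⟩ := exists_table_of_check (p := h + 1) (k := h) ls _ (supOK_of_spec (hRows_spec h)) hc
  refine ⟨P, ?_⟩
  rwa [rootInstW_matrix (hRows h) hWts (windowStart_succ_le_two_pow h)] at hP

end Cert

end Summit.ValiantsHypothesis.ValiantsHypothesis.Theorems.BarrierLever.ChowBenchmarkSplit
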